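import Summits.Ventures.QEDPrecision.SpectralMajorants.KMajorant
import Summits.Ventures.QEDPrecision.SpectralMajorants.J4Series
import Literature.Analysis.Quadrature.GaussLegendreAnalytic
import HarnessLib

/-!
# The Bernstein-region premise of the outer Gauss–Legendre remainder, kernel-checked
(venture QEDPrecision, cell `pub-qed`, literature seat, gen 13; folder `SpectralMajorants/`, file 4)

HONEST FRAMING (verbatim, venture QEDPrecision): independent recomputation; certified where stated,
statistical where stated; no new-physics claim.

## What this file is

§2.5 + §3.2 of the I(b)/I(c) certificate's premise note `certs/SetIbIc/repr/gl_bounds.md`.  The four outer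
integrands of the certificate are `F_Q(x) = c_Q (1−x) K(x)^m J₄(x)^n` with `(m, n, c_Q)` = C₈ `(1,1,2)`,
I(b) `(2,1,3)`, I(c) `(0,2,1)`, C₆ `(0,1,1)` (`K = ∫₀¹ρ₂/W`, `J₄ = ∫₀¹ρ₄/W`, typed in
`Literature/…/Jegerlehner2017/SpectralFunctionInsertions.lean`, p217042).  With the complex extensions
`kC`, `jC` of files 1 and 3b:

* `fQ c m n z := c·(1−z)·kC(z)^m·jC(z)^n` and `fQ_ofReal` : on `(0,1)` it IS the real integrand `fQre`;
* GEOMETRY (`norm_lt_discR`, `norm_one_sub_lt`): the kernel theorem's region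
  `{z : ‖z−a‖+‖z−b‖ < (ρ+ρ⁻¹)(b−a)/2}` lies in the disc `‖z‖ < r := c + s·h` and has `‖1−z‖ < (1−c) + s·h`
  (`c = (a+b)/2`, `h = (b−a)/2`, `s = (ρ+ρ⁻¹)/2`; the note's "D_k ⊂ {|z| ≤ r}");
* PREMISE (`differentiableOn_fQ`, `norm_fQ_le`): if `0 ≤ a < b` and `r < 1` then `fQ` is complex-
  differentiable on the region and bounded there by
  `M_Q(ρ) := mQ c m n a b ρ = c_Q·((1−c)+s·h)·𝒦(r)^m·𝒥(r)^n` — the note's (§2.5) display, symbol for symbol;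
* REMAINDER (`gl_remainder_fQ`, real form `gl_remainder_fQre`): hence, by the tree's KERNEL theorem
  `Literature.Analysis.Quadrature.norm_integral_sub_gaussLegendre_le_interval` (Trefethen 2008 Thm 4.5),
  for every `n ≥ 1`:  `|∫_a^b F_Q − Σ_{ξ ∈ nodes n} (h·w_ξ)·F_Q(hξ + c)| ≤ h·8·M_Q(ρ)/((ρ−1)ρ^{2n−1})`
  — EXACTLY the per-sub-interval inequality `R_{Q,k}` of gl_bounds.md §3.2 (`b1p_lib.gl_remainder`), now
  with its premise discharged in the kernel instead of on paper; specialisations `gl_remainder_C8/Ib/Ic/C6`.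

What stays outside the kernel (said plainly): the inner `t`-enclosures of `J₄` at the nodes and their two
a-priori series tails (§4), the end piece `[1−2^{−J}, 1]` (§5), the node/weight enclosures and all interval
arithmetic of the instrument (engines' cap.quad1d), and the per-row arithmetic `r < 1` / `M_{Q,k}` values of
`gl_schedule.md` (decidable numerics, evaluated by the program from THESE formulas).  No number moves; the
I(b)/I(c)-CERT values and labels are the lead's (D213/D220/D229/D230); not an R-row.

NEW WORK of the cell (elementary analysis about the cell's typed objects), not a published result; nothing
here is cited as a fact anywhere; no numerical value of any anomaly integral is asserted.
-/

noncomputable section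

open Real Set MeasureTheory intervalIntegral Finset

namespace Summit.Ventures.QEDPrecision.SpectralMajorants

open Literature.MathematicalPhysics.QuantumFieldTheory.Jegerlehner2017
open Literature.Analysis.SpecialFunctions (gaussLegendreNodes gaussLegendreWeight
  mem_Ioo_of_mem_gaussLegendreNodes)
open Literature.Analysis.Quadrature

/-! ### The integrands -/

/-- The complex outer integrand `F_Q(z) = c_Q (1−z) K(z)^m J₄(z)^n` (gl_bounds.md §1). -/
def fQ (cQ : ℝ) (m n : ℕ) (z : ℂ) : ℂ := (cQ : ℂ) * (1 - z) * kC z ^ m * jC z ^ n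

/-- The real outer integrand `F_Q(x) = c_Q (1−x) K(x)^m J₄(x)^n` with the TYPED inner integrals. -/
def fQre (cQ : ℝ) (m n : ℕ) (x : ℝ) : ℝ :=
  cQ * (1 - x) * (∫ t in (0:ℝ)..1, rho2 t / wt t x 1) ^ m * (∫ t in (0:ℝ)..1, rho4 t / wt t x 1) ^ n

/-- On `(0,1)` the complex integrand IS the real one. -/
theorem fQ_ofReal (cQ : ℝ) (m n : ℕ) {x : ℝ} (hx0 : 0 < x) (hx1 : x < 1) :
    fQ cQ m n (x : ℂ) = ((fQre cQ m n x : ℝ) : ℂ) := by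
  unfold fQ fQre
  rw [kC_ofReal hx0 hx1, jC_ofReal hx0 hx1]
  push_cast
  ring

/-- `fQ` is complex-differentiable on the open unit disc. -/
theorem differentiableOn_fQ_ball (cQ : ℝ) (m n : ℕ) :
    DifferentiableOn ℂ (fQ cQ m n) (Metric.ball (0 : ℂ) 1) := by
  unfold fQ
  exact (((differentiableOn_const _).mul ((differentiableOn_const _).sub differentiableOn_id)).mul
    (differentiableOn_kC.pow m)).mul (differentiableOn_jC.pow n)

/-! ### Geometry of the Bernstein region of `[a,b]` -/

/-- The radius of the note's disc `D_k`: `r = c + s·h`, `c = (a+b)/2`, `h = (b−a)/2`, `s = (ρ+ρ⁻¹)/2`. -/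
def discR (a b ρ : ℝ) : ℝ := (a + b) / 2 + (ρ + ρ⁻¹) / 2 * ((b - a) / 2)

/-- The note's majorant `M_Q(ρ) = c_Q·((1−c)+s·h)·𝒦(r)^m·𝒥(r)^n` on the disc (gl_bounds.md §2.5). -/
def mQ (cQ : ℝ) (m n : ℕ) (a b ρ : ℝ) : ℝ :=
  cQ * ((1 - (a + b) / 2) + (ρ + ρ⁻¹) / 2 * ((b - a) / 2)) * kMaj (discR a b ρ) ^ m * jMaj (discR a b ρ) ^ n

/-- In the region, `‖z − c‖ < s·h` (`2(z−c) = (z−a) + (z−b)`). -/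
theorem norm_sub_center_lt {a b ρ : ℝ} {z : ℂ}
    (hz : ‖z - a‖ + ‖z - b‖ < (ρ + ρ⁻¹) * ((b - a) / 2)) :
    ‖z - (((a + b) / 2 : ℝ) : ℂ)‖ < (ρ + ρ⁻¹) / 2 * ((b - a) / 2) := by
  have h2 : (2 : ℂ) * (z - (((a + b) / 2 : ℝ) : ℂ)) = (z - a) + (z - b) := by push_cast; ring
  have hn : 2 * ‖z - (((a + b) / 2 : ℝ) : ℂ)‖ ≤ ‖z - a‖ + ‖z - b‖ := by
    have := norm_add_le (z - a) (z - b)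
    rw [← h2, norm_mul] at this
    simpa using this
  linarith

/-- **Region ⊂ disc**: for `0 ≤ a`, every `z` of the region has `‖z‖ < r = discR a b ρ`. -/
theorem norm_lt_discR {a b ρ : ℝ} (ha : 0 ≤ a) (hab : a < b) {z : ℂ}
    (hz : ‖z - a‖ + ‖z - b‖ < (ρ + ρ⁻¹) * ((b - a) / 2)) : ‖z‖ < discR a b ρ := by
  have h1 := norm_sub_center_lt hz
  have hc0 : 0 ≤ (a + b) / 2 := by linarith
  have hc : ‖(((a + b) / 2 : ℝ) : ℂ)‖ = (a + b) / 2 := by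
    rw [Complex.norm_real, Real.norm_eq_abs, abs_of_nonneg hc0]
  have h3 : ‖z‖ ≤ ‖z - (((a + b) / 2 : ℝ) : ℂ)‖ + ‖(((a + b) / 2 : ℝ) : ℂ)‖ := by
    have := norm_add_le (z - (((a + b) / 2 : ℝ) : ℂ)) (((a + b) / 2 : ℝ) : ℂ)
    simpa using this
  unfold discR
  linarith

/-- In the region, `‖1 − z‖ < (1−c) + s·h` (when `c ≤ 1`, in particular when `r < 1`). -/
theorem norm_one_sub_lt {a b ρ : ℝ} (hc1 : (a + b) / 2 ≤ 1) {z : ℂ}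
    (hz : ‖z - a‖ + ‖z - b‖ < (ρ + ρ⁻¹) * ((b - a) / 2)) :
    ‖1 - z‖ < (1 - (a + b) / 2) + (ρ + ρ⁻¹) / 2 * ((b - a) / 2) := by
  have h1 := norm_sub_center_lt hz
  have hc : ‖(1 : ℂ) - (((a + b) / 2 : ℝ) : ℂ)‖ = 1 - (a + b) / 2 := by
    have : (1 : ℂ) - (((a + b) / 2 : ℝ) : ℂ) = (((1 - (a + b) / 2 : ℝ)) : ℂ) := by push_cast; ring
    rw [this, Complex.norm_real, Real.norm_eq_abs, abs_of_nonneg (by linarith)]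
  have h3 : ‖1 - z‖ ≤ ‖(1 : ℂ) - (((a + b) / 2 : ℝ) : ℂ)‖ + ‖(((a + b) / 2 : ℝ) : ℂ) - z‖ := by
    have := norm_add_le ((1 : ℂ) - (((a + b) / 2 : ℝ) : ℂ)) ((((a + b) / 2 : ℝ) : ℂ) - z)
    simpa using this
  rw [norm_sub_rev (((a + b) / 2 : ℝ) : ℂ) z] at h3
  linarith

/-- `s = (ρ+ρ⁻¹)/2 ≥ 1` for `ρ > 0`, hence `b ≤ r` and `c ≤ r`. -/
theorem one_le_half_rho_add_inv {ρ : ℝ} (hρ : 0 < ρ) : 1 ≤ (ρ + ρ⁻¹) / 2 := by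
  have h : 2 ≤ ρ + ρ⁻¹ := by
    have hρ' : ρ⁻¹ = 1 / ρ := inv_eq_one_div ρ
    rw [hρ', ← sub_nonneg]
    have : ρ + 1 / ρ - 2 = (ρ - 1) ^ 2 / ρ := by field_simp; ring
    rw [this]; positivity
  linarith

/-- `b ≤ r`. -/
theorem le_discR {a b ρ : ℝ} (hab : a < b) (hρ : 0 < ρ) : b ≤ discR a b ρ := by
  unfold discR
  have hs := one_le_half_rho_add_inv hρ
  have hh : 0 < (b - a) / 2 := by linarith
  nlinarith

/-! ### The premise: analyticity and the bound `M_Q` on the region -/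

/-- **Premise, part 1**: `F_Q` is complex-differentiable on the Bernstein region of `[a,b]` whenever
`0 ≤ a < b` and `r = discR a b ρ < 1` (gl_bounds.md §2.1/§2.5, D201 O3). -/
theorem differentiableOn_fQ (cQ : ℝ) (m n : ℕ) {a b ρ : ℝ} (ha : 0 ≤ a) (hab : a < b)
    (hr : discR a b ρ < 1) :
    DifferentiableOn ℂ (fQ cQ m n) {z : ℂ | ‖z - a‖ + ‖z - b‖ < (ρ + ρ⁻¹) * ((b - a) / 2)} := by
  refine (differentiableOn_fQ_ball cQ m n).mono ?_
  intro z hz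
  rw [Metric.mem_ball, dist_zero_right]
  exact (norm_lt_discR ha hab hz).trans hr

/-- **Premise, part 2**: on the region, `‖F_Q(z)‖ ≤ M_Q(ρ) = c_Q((1−c)+s·h)𝒦(r)^m𝒥(r)^n`
(gl_bounds.md §2.5). -/
theorem norm_fQ_le {cQ : ℝ} (hc : 0 ≤ cQ) (m n : ℕ) {a b ρ : ℝ} (ha : 0 ≤ a) (hab : a < b)
    (hρ : 0 < ρ) (hr : discR a b ρ < 1) (z : ℂ)
    (hz : ‖z - a‖ + ‖z - b‖ < (ρ + ρ⁻¹) * ((b - a) / 2)) :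
    ‖fQ cQ m n z‖ ≤ mQ cQ m n a b ρ := by
  have hzr : ‖z‖ ≤ discR a b ρ := (norm_lt_discR ha hab hz).le
  have hr0 : 0 ≤ discR a b ρ := (norm_nonneg z).trans hzr
  have hc1 : (a + b) / 2 ≤ 1 := by
    have := le_discR hab hρ; linarith
  have h1z := (norm_one_sub_lt hc1 hz).le
  have hK := norm_kC_le_of_norm_le hzr hr
  have hJ := norm_jC_le hzr hr
  have hK0 : 0 ≤ kMaj (discR a b ρ) := kMaj_nonneg hr0 hr
  have hJ0 : 0 ≤ jMaj (discR a b ρ) := jMaj_nonneg hr0 hr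
  unfold fQ mQ
  rw [norm_mul, norm_mul, norm_mul, norm_pow, norm_pow, Complex.norm_real, Real.norm_eq_abs,
    abs_of_nonneg hc]
  have hKm : ‖kC z‖ ^ m ≤ kMaj (discR a b ρ) ^ m := pow_le_pow_left₀ (norm_nonneg _) hK m
  have hJn : ‖jC z‖ ^ n ≤ jMaj (discR a b ρ) ^ n := pow_le_pow_left₀ (norm_nonneg _) hJ n
  gcongr

/-! ### The per-sub-interval Gauss–Legendre remainder (gl_bounds.md §3.2), premise discharged -/

/-- **The outer remainder with kernel premise** (complex form): for `0 ≤ a < b`, `1 < ρ`, `r < 1`, `n ≥ 1`,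
`‖∫_a^b F_Q − Σ_ξ (h w_ξ) F_Q(hξ+c)‖ ≤ h · 8 M_Q(ρ) / ((ρ−1) ρ^{2n−1})` — the tree's
`norm_integral_sub_gaussLegendre_le_interval` with its two hypotheses supplied by `differentiableOn_fQ`
and `norm_fQ_le`. -/
theorem gl_remainder_fQ {cQ : ℝ} (hc : 0 ≤ cQ) (m n : ℕ) {a b ρ : ℝ} (ha : 0 ≤ a) (hab : a < b)
    (hρ : 1 < ρ) (hr : discR a b ρ < 1) {N : ℕ} (hN : 1 ≤ N) :
    ‖(∫ t in a..b, fQ cQ m n t) - ∑ x ∈ gaussLegendreNodes N,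
        ((b - a) / 2 * gaussLegendreWeight N x : ℂ) * fQ cQ m n ((b - a) / 2 * x + (a + b) / 2)‖ ≤
      (b - a) / 2 * (8 * mQ cQ m n a b ρ / ((ρ - 1) * ρ ^ (2 * N - 1))) :=
  norm_integral_sub_gaussLegendre_le_interval hρ hab (differentiableOn_fQ cQ m n ha hab hr)
    (fun z hz => norm_fQ_le hc m n ha hab (by linarith) hr z hz) hN

/-- **The outer remainder with kernel premise, real form**: the same inequality for the real integrand
`fQre` (the typed `K`, `J₄`) and the real `n`-point Gauss–Legendre sum on `[a,b]`. -/
theorem gl_remainder_fQre {cQ : ℝ} (hc : 0 ≤ cQ) (m n : ℕ) {a b ρ : ℝ} (ha : 0 ≤ a) (hab : a < b)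
    (hρ : 1 < ρ) (hr : discR a b ρ < 1) {N : ℕ} (hN : 1 ≤ N) :
    |(∫ x in a..b, fQre cQ m n x) - ∑ ξ ∈ gaussLegendreNodes N,
        ((b - a) / 2 * gaussLegendreWeight N ξ) * fQre cQ m n ((b - a) / 2 * ξ + (a + b) / 2)| ≤
      (b - a) / 2 * (8 * mQ cQ m n a b ρ / ((ρ - 1) * ρ ^ (2 * N - 1))) := by
  have H := gl_remainder_fQ hc m n ha hab hρ hr hN
  have hb1 : b < 1 := lt_of_le_of_lt (le_discR hab (by linarith)) hr
  -- the integral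
  have hint : (∫ t in a..b, fQ cQ m n t) = (((∫ x in a..b, fQre cQ m n x) : ℝ) : ℂ) := by
    rw [← intervalIntegral.integral_ofReal]
    refine intervalIntegral.integral_congr_uIoo ?_
    intro x hx
    rw [uIoo_of_le hab.le] at hx
    exact fQ_ofReal cQ m n (by linarith [hx.1]) (by linarith [hx.2])
  -- the sum
  have hsum : ∑ x ∈ gaussLegendreNodes N,
      ((b - a) / 2 * gaussLegendreWeight N x : ℂ) * fQ cQ m n ((b - a) / 2 * x + (a + b) / 2)
      = (((∑ ξ ∈ gaussLegendreNodes N,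
          ((b - a) / 2 * gaussLegendreWeight N ξ) * fQre cQ m n ((b - a) / 2 * ξ + (a + b) / 2)) : ℝ) : ℂ) := by
    rw [Complex.ofReal_sum]
    refine Finset.sum_congr rfl fun ξ hξ => ?_
    have hI := mem_Ioo_of_mem_gaussLegendreNodes hξ
    have hp0 : 0 < (b - a) / 2 * ξ + (a + b) / 2 := by nlinarith [hI.1, hI.2]
    have hp1 : (b - a) / 2 * ξ + (a + b) / 2 < 1 := by nlinarith [hI.1, hI.2]
    have harg : ((b - a) / 2 * ξ + (a + b) / 2 : ℂ) = (((b - a) / 2 * ξ + (a + b) / 2 : ℝ) : ℂ) := by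
      push_cast; ring
    rw [harg, fQ_ofReal cQ m n hp0 hp1]
    push_cast
    ring
  rw [hint, hsum, ← Complex.ofReal_sub, Complex.norm_real, Real.norm_eq_abs] at H
  exact H

/-! ### The four quantities of the certificate -/

/-- C₈ (the CONTROL, eighth-order Set I(b)⁽⁸⁾): `F = 2(1−x)K J₄`. -/
theorem fQre_C8 (x : ℝ) : fQre 2 1 1 x =
    2 * (1 - x) * (∫ t in (0:ℝ)..1, rho2 t / wt t x 1) * (∫ t in (0:ℝ)..1, rho4 t / wt t x 1) := by
  simp [fQre]

/-- I(b): `F = 3(1−x)K² J₄` (the integrand of `setIbRep`). -/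
theorem fQre_Ib (x : ℝ) : fQre 3 2 1 x =
    3 * (1 - x) * (∫ t in (0:ℝ)..1, rho2 t / wt t x 1) ^ 2 * (∫ t in (0:ℝ)..1, rho4 t / wt t x 1) := by
  simp [fQre]

/-- I(c): `F = (1−x)J₄²` (the integrand of `setIcRep = seqInsertion rho4 2 1`). -/
theorem fQre_Ic (x : ℝ) : fQre 1 0 2 x = (1 - x) * (∫ t in (0:ℝ)..1, rho4 t / wt t x 1) ^ 2 := by
  simp [fQre]

/-- C₆ (shakedown): `F = (1−x)J₄` (the integrand of `seqInsertion rho4 1 1`). -/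
theorem fQre_C6 (x : ℝ) : fQre 1 0 1 x = (1 - x) * (∫ t in (0:ℝ)..1, rho4 t / wt t x 1) := by
  simp [fQre]

/-- **R_{I(c),k} with kernel premise**: on a sub-interval `[a,b]` with `0 ≤ a < b`, `1 < ρ`,
`r = (a+b)/2 + ((ρ+ρ⁻¹)/2)((b−a)/2) < 1`, the `n`-point Gauss–Legendre rule for `∫_a^b (1−x)J₄(x)² dx`
errs by at most `((b−a)/2)·8·M/((ρ−1)ρ^{2n−1})`, `M = ((1−c)+s·h)·𝒥(r)²`. -/
theorem gl_remainder_Ic {a b ρ : ℝ} (ha : 0 ≤ a) (hab : a < b) (hρ : 1 < ρ) (hr : discR a b ρ < 1)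
    {N : ℕ} (hN : 1 ≤ N) :
    |(∫ x in a..b, (1 - x) * (∫ t in (0:ℝ)..1, rho4 t / wt t x 1) ^ 2) - ∑ ξ ∈ gaussLegendreNodes N,
        ((b - a) / 2 * gaussLegendreWeight N ξ) *
          ((1 - ((b - a) / 2 * ξ + (a + b) / 2)) *
            (∫ t in (0:ℝ)..1, rho4 t / wt t ((b - a) / 2 * ξ + (a + b) / 2) 1) ^ 2)| ≤
      (b - a) / 2 * (8 * (((1 - (a + b) / 2) + (ρ + ρ⁻¹) / 2 * ((b - a) / 2)) * jMaj (discR a b ρ) ^ 2)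
        / ((ρ - 1) * ρ ^ (2 * N - 1))) := by
  have H := gl_remainder_fQre (cQ := 1) zero_le_one 0 2 ha hab hρ hr hN
  simp only [fQre_Ic, mQ, pow_zero, one_mul, mul_one] at H
  exact H

/-- **R_{I(b),k} with kernel premise** (`M = 3((1−c)+s·h)𝒦(r)²𝒥(r)`). -/
theorem gl_remainder_Ib {a b ρ : ℝ} (ha : 0 ≤ a) (hab : a < b) (hρ : 1 < ρ) (hr : discR a b ρ < 1)
    {N : ℕ} (hN : 1 ≤ N) :
    |(∫ x in a..b, 3 * (1 - x) * (∫ t in (0:ℝ)..1, rho2 t / wt t x 1) ^ 2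
        * (∫ t in (0:ℝ)..1, rho4 t / wt t x 1)) - ∑ ξ ∈ gaussLegendreNodes N,
        ((b - a) / 2 * gaussLegendreWeight N ξ) *
          (3 * (1 - ((b - a) / 2 * ξ + (a + b) / 2)) *
            (∫ t in (0:ℝ)..1, rho2 t / wt t ((b - a) / 2 * ξ + (a + b) / 2) 1) ^ 2 *
            (∫ t in (0:ℝ)..1, rho4 t / wt t ((b - a) / 2 * ξ + (a + b) / 2) 1))| ≤
      (b - a) / 2 * (8 * (3 * ((1 - (a + b) / 2) + (ρ + ρ⁻¹) / 2 * ((b - a) / 2))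
        * kMaj (discR a b ρ) ^ 2 * jMaj (discR a b ρ)) / ((ρ - 1) * ρ ^ (2 * N - 1))) := by
  have H := gl_remainder_fQre (cQ := 3) (by norm_num) 2 1 ha hab hρ hr hN
  simp only [fQre_Ib, mQ, pow_one] at H
  exact H

/-- **R_{C₈,k} with kernel premise** (`M = 2((1−c)+s·h)𝒦(r)𝒥(r)`; the CONTROL's remainder). -/
theorem gl_remainder_C8 {a b ρ : ℝ} (ha : 0 ≤ a) (hab : a < b) (hρ : 1 < ρ) (hr : discR a b ρ < 1)
    {N : ℕ} (hN : 1 ≤ N) :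
    |(∫ x in a..b, 2 * (1 - x) * (∫ t in (0:ℝ)..1, rho2 t / wt t x 1)
        * (∫ t in (0:ℝ)..1, rho4 t / wt t x 1)) - ∑ ξ ∈ gaussLegendreNodes N,
        ((b - a) / 2 * gaussLegendreWeight N ξ) *
          (2 * (1 - ((b - a) / 2 * ξ + (a + b) / 2)) *
            (∫ t in (0:ℝ)..1, rho2 t / wt t ((b - a) / 2 * ξ + (a + b) / 2) 1) *
            (∫ t in (0:ℝ)..1, rho4 t / wt t ((b - a) / 2 * ξ + (a + b) / 2) 1))| ≤
      (b - a) / 2 * (8 * (2 * ((1 - (a + b) / 2) + (ρ + ρ⁻¹) / 2 * ((b - a) / 2))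
        * kMaj (discR a b ρ) * jMaj (discR a b ρ)) / ((ρ - 1) * ρ ^ (2 * N - 1))) := by
  have H := gl_remainder_fQre (cQ := 2) (by norm_num) 1 1 ha hab hρ hr hN
  simp only [fQre_C8, mQ, pow_one] at H
  exact H

/-- **R_{C₆,k} with kernel premise** (`M = ((1−c)+s·h)𝒥(r)`; the shakedown line). -/
theorem gl_remainder_C6 {a b ρ : ℝ} (ha : 0 ≤ a) (hab : a < b) (hρ : 1 < ρ) (hr : discR a b ρ < 1)
    {N : ℕ} (hN : 1 ≤ N) :
    |(∫ x in a..b, (1 - x) * (∫ t in (0:ℝ)..1, rho4 t / wt t x 1)) - ∑ ξ ∈ gaussLegendreNodes N,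
        ((b - a) / 2 * gaussLegendreWeight N ξ) *
          ((1 - ((b - a) / 2 * ξ + (a + b) / 2)) *
            (∫ t in (0:ℝ)..1, rho4 t / wt t ((b - a) / 2 * ξ + (a + b) / 2) 1))| ≤
      (b - a) / 2 * (8 * (((1 - (a + b) / 2) + (ρ + ρ⁻¹) / 2 * ((b - a) / 2)) * jMaj (discR a b ρ))
        / ((ρ - 1) * ρ ^ (2 * N - 1))) := by
  have H := gl_remainder_fQre (cQ := 1) zero_le_one 0 1 ha hab hρ hr hN
  simp only [fQre_C6, mQ, pow_zero, pow_one, one_mul, mul_one] at H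
  exact H

end Summit.Ventures.QEDPrecision.SpectralMajorants

end
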